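import Literature.Barriers.PneNP.MonotoneGapProofs
import Literature.Computability.Complexity.CliqueSqrtLowerBound
import Literature.Computability.Complexity.CircuitLightCone
import Mathlib.Analysis.Complex.ExponentialBounds
import Mathlib.Algebra.Order.Field.GeomSum
import HarnessLib

/-!
# The monotone gap: discharge of the lower-bound half

`MonotoneGapProofs.lean` splits Tardos's theorem `Literature.Barriers.PneNP.MonotoneGap` into
the named facts `Jukna2012_cliqueLike_sqrt_lowerBound` (every `(⌊√n⌋ - 1, ⌊√n⌋)`-clique function
needs monotone circuits of size `2^{c n^{1/8}}`) and `Tardos1988_cliqueLike_polysize` (such a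
function with polynomial-size De Morgan circuits exists — Lovász's `ϑ`, Grötschel–Lovász–
Schrijver), and proves `MonotoneGap_of_facts`. This file DISCHARGES the first:

* `Jukna2012_cliqueLike_sqrt_lowerBound_holds` — from the proved approximation-method bound
  `Literature.Computability.Complexity.cliqueSqrt_monotone_lowerBound`
  (`CliqueSqrtLowerBound.lean`: `razborov_dichotomy_wide` in the lattice `K(m, r, l)` with
  `l = ⌊m^{1/8}⌋`, `r = ⌈m^{1/4}/e⌉`, and the two counting estimates), with `c = 1`;
* `MonotoneGap_of_polysize : Tardos1988_cliqueLike_polysize → MonotoneGap` — the reduced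
  assembly: after this file `MonotoneGap` rests on the single named fact
  `Tardos1988_cliqueLike_polysize`.

It then DISCHARGES the general fact `Jukna2012_cliqueLike_lowerBound` (Jukna 2012, Thm. 9.26
for monotone Boolean circuits: every `(a, b)`-clique function, `32 ≤ a < b ≤ n/32`, needs
`2^{c · min(a, n/b)^{1/4}}` gates), `Jukna2012_cliqueLike_lowerBound_holds`, with `c = 1/4` and
`n ≥ 64`. With `E = min(a, n/b)^{1/4}` there are two regimes:

* `2^{E/4} ≤ n/4`: the trivial bound `n ≤ b + 2 · size` (`le_add_two_mul_size`) — the output of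
  a fan-in-`2` circuit with `t` gates depends only on the `≤ 2t` edge variables of its light
  cone (`CircuitLightCone.lean`), and every `b`-set of vertices must span one of them, since a
  clique-like function separates the `b`-clique from the empty graph; deleting one endpoint per
  edge shows `n < b + 2t` (`lt_add_card_of_forall_exists_isLive`);
* `2^{E/4} > n/4` (so `E > 16` and `log(n+1) ≤ (E log 2)/4 + log 8`): Razborov's approximation
  method in the Alon–Boppana lattice, wide regime (`razborov_dichotomy_wide`) with `b`-cliques,
  `a`-colourings, `l = ⌊E⌋` and `r = ⌊E²/3⌋` (`cliqueLike_lowerBound_main`); the two counting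
  estimates are `caseA_general` (`E^{2r} ≤ t (n+1)^l`, using `l² ≤ E²`, `a ≥ E⁴`) and
  `caseB_general` (`9^l ≤ 2t`, using `9 (r-1)² b ≤ n`).

The book proves Thm. 9.26 (for monotone REAL circuits) through the length-measure criterion
Thm. 9.25, which is not in the tree; the exponent `min(a, n/b)^{1/4}` obtained here is the same.

## References

* [Tardos1988] p. 141, Corollary (Razborov; Alon–Boppana) with `f(v) = ⌊√v⌋` (held).
* [Jukna2012] Thm. 9.26 and the proof of Thm. 9.28 (PDF pp. 283–286).
* [AlonBoppana1987] Thm. 2.1, Lemmas 3.13–3.14.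
* [Jukna2012] §9.7–9.8, Def. 9.24, Thm. 9.25, Thm. 9.26 and its proof (PDF pp. 281–285), for
  the general `(a, b)` bound.
-/

noncomputable section

namespace Literature.Barriers.PneNP

open Literature.Computability.Complexity Filter Finset

/-- **Discharge of `Jukna2012_cliqueLike_sqrt_lowerBound`** (Tardos 1988, p. 141, Corollary
(Razborov; Alon–Boppana) with `f(v) = ⌊√v⌋`; Jukna 2012, Thm. 9.26 and the lower-bound half of
Thm. 9.28): with `c = 1`, for all large `n` every `(⌊√n⌋ - 1, ⌊√n⌋)`-clique function needs
monotone `{∧₂, ∨₂}`-circuits of size `≥ 2^{n^{1/8}}` — Razborov's approximation method in the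
wide regime, `Literature.Computability.Complexity.cliqueSqrt_monotone_lowerBound`, fed with the
two test behaviours of a clique-like function.
[cite: Tardos1988, p. 141 (Corollary)] [cite: Jukna2012, Thm. 9.26 and Thm. 9.28 (PDF pp. 283–286)] -/
theorem Jukna2012_cliqueLike_sqrt_lowerBound_holds : Jukna2012_cliqueLike_sqrt_lowerBound := by
  refine ⟨1, one_pos, ?_⟩
  filter_upwards [cliqueSqrt_monotone_lowerBound] with n hn f hf C hCB hCf
  rw [one_mul]
  refine hn f (fun Z hZ => hf.accepts Z (subset_univ _) hZ) (fun O => ?_) C hCB hCf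
  have h := hf.rejects O
  rwa [colorTest_univ] at h

/-- **`MonotoneGap` from the upper-bound fact alone.** After
`Jukna2012_cliqueLike_sqrt_lowerBound_holds`, Tardos's gap theorem
`Literature.Barriers.PneNP.MonotoneGap` rests on the single named fact
`Tardos1988_cliqueLike_polysize` (a `(⌊√n⌋ - 1, ⌊√n⌋)`-clique function with polynomial-size
De Morgan circuits: Lovász's `ϑ` sandwich and the Grötschel–Lovász–Schrijver polynomial-time
approximation of `ϑ`). [cite: Tardos1988, pp. 141–142] [cite: Jukna2012, Lemma 9.27 and Thm. 9.28 (PDF p. 286)] -/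
theorem MonotoneGap_of_polysize (hUB : Tardos1988_cliqueLike_polysize) : MonotoneGap :=
  MonotoneGap_of_facts Jukna2012_cliqueLike_sqrt_lowerBound_holds hUB

/-! ## The general `(a, b)`-clique bound (Jukna 2012, Thm. 9.26) -/

section General

open Real

/-! ### A trivial lower bound: every `b`-set of vertices contains an edge read by the circuit -/

/-- The light cones of a program with fan-in `≤ K` all lie in a set of at most `K · (#gates)`
input variables (the variables read directly by some gate). [folklore] -/
theorem exists_deps_subset {ι : Type*} [DecidableEq ι] (gs : List (Gate ι)) {K : ℕ}
    (hgs : ∀ g ∈ gs, g.arity ≤ K) :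
    ∃ R : Finset ι, #R ≤ K * gs.length ∧ ∀ m, (GateList.deps gs).getD m ∅ ⊆ R := by
  induction gs using List.reverseRecOn with
  | nil => exact ⟨∅, by simp, fun m => by simp [GateList.deps]⟩
  | append_singleton gs g ih =>
    obtain ⟨R, hR, hsub⟩ := ih fun g' hg' => hgs g' (by simp [hg'])
    have hg : g.arity ≤ K := hgs g (by simp)
    set I : Finset ι := univ.biUnion fun a => match g.args a with
      | .inl i => ({i} : Finset ι)
      | .inr _ => ∅ with hI_def
    have hI : #I ≤ K := by
      calc #I ≤ ∑ a, #(match g.args a with | .inl i => ({i} : Finset ι) | .inr _ => ∅) :=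
            card_biUnion_le
        _ ≤ ∑ _a : Fin g.arity, 1 := sum_le_sum fun a _ => by
            cases g.args a <;> simp
        _ = g.arity := by simp
        _ ≤ K := hg
    refine ⟨R ∪ I, ?_, fun m => ?_⟩
    · calc #(R ∪ I) ≤ #R + #I := card_union_le _ _
        _ ≤ K * gs.length + K := Nat.add_le_add hR hI
        _ = K * (gs ++ [g]).length := by simp [mul_add]
    · rw [GateList.deps_append_singleton]
      rcases lt_or_ge m gs.length with h | h
      · rw [List.getD_append _ _ _ _ (by simpa using h)]
        exact (hsub m).trans subset_union_left
      · rw [List.getD_append_right _ _ _ _ (by simpa using h)]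
        rcases Nat.lt_or_ge (m - gs.length) 1 with h1 | h1
        · have h0 : m - (GateList.deps gs).length = 0 := by simp; omega
          rw [h0, List.getD_cons_zero]
          intro i hi
          simp only [GateList.depOf, mem_biUnion, mem_univ, true_and] at hi
          obtain ⟨a, ha⟩ := hi
          cases hga : g.args a with
          | inl j =>
            rw [hga] at ha
            refine mem_union_right _ (mem_biUnion.2 ⟨a, mem_univ _, ?_⟩)
            rw [hga]
            exact ha
          | inr m' =>
            rw [hga] at ha
            exact mem_union_left _ (hsub m' ha)
        · rw [List.getD_eq_default _ _ (by simp; omega)]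
          exact empty_subset _

/-- The light cone of a circuit over the monotone basis `{∧₂, ∨₂}` with `t` gates has at most
`2t` variables, unless the output wire is an input variable (then it is that variable).
[folklore] -/
theorem card_lightCone_le_or {ι : Type*} [DecidableEq ι] (C : Circuit ι)
    (hC : C.IsOver monotoneBasis) :
    #C.lightCone ≤ 2 * C.size ∨ ∃ i, C.lightCone = {i} := by
  have harity : ∀ g ∈ C.gates, g.arity ≤ 2 := fun g hg =>
    deMorganBasis_subset_B2 (monotoneBasis_subset_deMorgan (hC g hg))
  obtain ⟨R, hR, hsub⟩ := exists_deps_subset C.gates harity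
  unfold Circuit.lightCone
  cases C.output with
  | inl i => exact Or.inr ⟨i, rfl⟩
  | inr m => exact Or.inl ((card_le_card (hsub m)).trans hR)

/-- If every `b`-set of vertices of `K_n` contains both endpoints of some edge of `L`, then
`n < b + |L|`: delete one endpoint of each edge of `L`; what remains spans no edge of `L`, so
has fewer than `b` vertices. [folklore] -/
theorem lt_add_card_of_forall_exists_isLive {n b : ℕ} (L : Finset (KEdge n))
    (hL : ∀ Z : Finset (Fin n), #Z = b → ∃ e ∈ L, IsLive Z e) : n < b + #L := by
  classical
  by_contra hge
  push Not at hge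
  -- one endpoint per edge
  set W : Finset (Fin n) := L.image fun e : KEdge n => (e.1 : Sym2 (Fin n)).out.1 with hW
  have hWcard : #W ≤ #L := card_image_le
  have hU : b ≤ #(univ \ W) := by
    rw [card_sdiff_of_subset (subset_univ _), card_univ, Fintype.card_fin]
    omega
  obtain ⟨Z, hZU, hZ⟩ := exists_subset_card_eq hU
  obtain ⟨e, heL, he⟩ := hL Z hZ
  have h1 : (e.1 : Sym2 (Fin n)).out.1 ∈ Z := he _ (Sym2.out_fst_mem _)
  have h2 : (e.1 : Sym2 (Fin n)).out.1 ∈ W := mem_image.2 ⟨e, heL, rfl⟩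
  exact (mem_sdiff.1 (hZU h1)).2 h2

/-- **Trivial size bound.** If `f` accepts every `b`-clique and rejects the empty graph, then a
circuit over `{∧₂, ∨₂}` computing `f` with `t` gates has `n ≤ b + 2t`: its output depends only
on the at most `2t` edge variables in its light cone, and every `b`-set must span one of them
(otherwise the `b`-clique and the empty graph agree on the light cone). [folklore] -/
theorem le_add_two_mul_size {n b : ℕ} {f : (KEdge n → Bool) → Bool}
    (hpos : ∀ Z : Finset (Fin n), #Z = b → f (cliqueVec Z) = true)
    (h0 : f (fun _ => false) = false)
    (C : Circuit (KEdge n)) (hCB : C.IsOver monotoneBasis) (hCf : C.Computes f) :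
    n ≤ b + 2 * C.size := by
  classical
  have hlive : ∀ Z : Finset (Fin n), #Z = b → ∃ e ∈ C.lightCone, IsLive Z e := by
    intro Z hZ
    by_contra hno
    push Not at hno
    have hagree : ∀ e ∈ C.lightCone, cliqueVec Z e = (fun _ => false) e := by
      intro e he
      have : ¬ cliqueVec Z e = true := fun h => hno e he ((cliqueVec_eq_true_iff Z e).1 h)
      simpa using this
    have h := C.eval_congr_lightCone hagree
    rw [hCf, hCf, hpos Z hZ, h0] at h
    exact Bool.noConfusion h
  have hlt := lt_add_card_of_forall_exists_isLive C.lightCone hlive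
  rcases card_lightCone_le_or C hCB with h | ⟨i, hi⟩
  · omega
  · rw [hi, card_singleton] at hlt
    omega


/-! ### Case 2 of the final count (the approximator is `≡ 1`), general parameters -/

/-- **Case 2 of the final count, general parameters** (Alon–Boppana 1987, proof of Lemma 3.14,
Case 2; Jukna 2012, proof of Thm. 9.26, Case 2, crude constants): with `E ≥ 16`,
`1 ≤ l ≤ E`, `g ≥ E⁴` colours, `r ≥ E²/3 - 1`, `N ≤ (m+1)^l` and
`log(m+1) ≤ (E log 2)/4 + log 8`, the inequality
`g^m (g^l)^r ≤ t · N · (g^l - g(g-1)⋯(g-l+1))^r · g^m` forces `t ≥ 2^{E/4}`: indeed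
`g^l - g(g-1)⋯(g-l+1) ≤ g^l l²/g ≤ g^l E⁻²`, so `E^{2r} ≤ t (m+1)^l`, and
`2 r log E ≥ (4/3) E² - 4` beats `l log(m+1) + (E log 2)/4 ≤ E²/4 + 13E/4`.
[cite: AlonBoppana1987, Lemma 3.14] [cite: Jukna2012, Thm. 9.26 (PDF p. 284)] -/
theorem caseA_general {m g l r N t : ℕ} {E : ℝ} (hE : 16 ≤ E) (hl1 : 1 ≤ l)
    (hlE : (l : ℝ) ≤ E) (hg : E ^ 4 ≤ g) (hr : E ^ 2 / 3 - 1 ≤ r)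
    (hN : (N : ℝ) ≤ ((m : ℝ) + 1) ^ l)
    (hm1 : Real.log ((m : ℝ) + 1) ≤ E * Real.log 2 / 4 + Real.log 8)
    (h : g ^ m * (g ^ l) ^ r ≤ t * (N * ((g ^ l - g.descFactorial l) ^ r * g ^ m))) :
    exp (E * Real.log 2 / 4) ≤ t := by
  have hE1 : (1 : ℝ) ≤ E := by linarith
  have hEpos : (0 : ℝ) < E := by linarith
  -- `g` is large: `g ≥ E⁴ ≥ E ≥ l`
  have hE4 : E ≤ E ^ 4 := le_self_pow₀ hE1 (by norm_num)
  have hlg' : (l : ℝ) ≤ g := hlE.trans (hE4.trans hg)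
  have hlg : l ≤ g := by exact_mod_cast hlg'
  have hl1' : (1 : ℝ) ≤ l := by exact_mod_cast hl1
  have hgpos : (0 : ℝ) < g := by linarith
  have hg0 : 0 < g := by exact_mod_cast hgpos
  -- the players as reals
  set a : ℝ := (g : ℝ) ^ l with ha_def
  set d : ℝ := (g.descFactorial l : ℝ) with hd_def
  have ha : 0 < a := by positivity
  have hdle : g.descFactorial l ≤ g ^ l := Nat.descFactorial_le_pow g l
  have hda : d ≤ a := by rw [hd_def, ha_def]; exact_mod_cast hdle
  -- cast the hypothesis and cancel `g^m`
  have hR : (g : ℝ) ^ m * a ^ r ≤ t * (N * ((a - d) ^ r * (g : ℝ) ^ m)) := by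
    have := (Nat.cast_le (α := ℝ)).2 h
    push_cast [Nat.cast_sub hdle] at this
    exact this
  have hgm : 0 < (g : ℝ) ^ m := by positivity
  have h1 : a ^ r ≤ t * N * (a - d) ^ r := by
    rw [show (t : ℝ) * (N * ((a - d) ^ r * (g : ℝ) ^ m)) = (t * N * (a - d) ^ r) * (g : ℝ) ^ m by
      ring, mul_comm] at hR
    exact le_of_mul_le_mul_right hR hgm
  -- `a - d ≤ a y` with `y = l²/g ≤ E⁻²`
  have hdesc : a * (1 - (l : ℝ) * l / g) ≤ d := pow_mul_one_sub_le_descFactorial hlg hg0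
  set y : ℝ := (l : ℝ) * l / g with hy_def
  have hy0 : 0 ≤ y := by positivity
  have had : a - d ≤ a * y := by
    have : a * (1 - y) = a - a * y := by ring
    linarith
  have h0ad : 0 ≤ a - d := by linarith
  have h2 : (a - d) ^ r ≤ a ^ r * y ^ r := by
    rw [← mul_pow]; exact pow_le_pow_left₀ h0ad had r
  have h3 : 1 * a ^ r ≤ (t * N * y ^ r) * a ^ r := by
    calc 1 * a ^ r = a ^ r := one_mul _
      _ ≤ t * N * (a - d) ^ r := h1
      _ ≤ t * N * (a ^ r * y ^ r) := mul_le_mul_of_nonneg_left h2 (by positivity)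
      _ = (t * N * y ^ r) * a ^ r := by ring
  have h4 : 1 ≤ t * N * y ^ r := le_of_mul_le_mul_right h3 (pow_pos ha r)
  have hE2 : 0 < E ^ 2 := by positivity
  have hyE : y ≤ (E ^ 2)⁻¹ := by
    rw [hy_def, div_le_iff₀ hgpos]
    calc (l : ℝ) * l ≤ E * E := mul_le_mul hlE hlE (Nat.cast_nonneg l) hEpos.le
      _ = (E ^ 2)⁻¹ * E ^ 4 := by rw [eq_inv_mul_iff_mul_eq₀ hE2.ne']; ring
      _ ≤ (E ^ 2)⁻¹ * g := mul_le_mul_of_nonneg_left hg (by positivity)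
  -- hence `(E²)^r ≤ t N`
  have h5 : (E ^ 2) ^ r ≤ t * N := by
    have hE2r : 0 < (E ^ 2) ^ r := by positivity
    have h6 : 1 ≤ t * N * ((E ^ 2)⁻¹) ^ r :=
      h4.trans (mul_le_mul_of_nonneg_left (pow_le_pow_left₀ hy0 hyE r) (by positivity))
    have := mul_le_mul_of_nonneg_right h6 hE2r.le
    rwa [one_mul, mul_assoc, ← mul_pow, inv_mul_cancel₀ hE2.ne', one_pow, mul_one] at this
  -- numerics: `log 2 ≤ 1`, `log 8 ≤ 3`, `log E ≥ 2` (`e² < 7.4 ≤ 16 ≤ E`)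
  have hlog2 : Real.log 2 ≤ 1 := by
    rw [Real.log_le_iff_le_exp two_pos]
    linarith [add_one_le_exp (1 : ℝ)]
  have hlog8 : Real.log 8 ≤ 3 := by
    rw [show (8 : ℝ) = 2 ^ 3 by norm_num, Real.log_pow]
    push_cast
    linarith
  have hlogE : 2 ≤ Real.log E := by
    rw [Real.le_log_iff_exp_le hEpos]
    have h1 : exp 2 = exp 1 * exp 1 := by rw [← exp_add]; norm_num
    rw [h1]
    nlinarith [Real.exp_one_lt_d9, exp_pos (1 : ℝ)]
  -- `N ≤ exp(E (E log 2 / 4 + log 8))`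
  have hm0 : (0 : ℝ) < (m : ℝ) + 1 := by positivity
  have hN' : (N : ℝ) ≤ exp (E * (E * Real.log 2 / 4 + Real.log 8)) := by
    have hl0 : 0 ≤ Real.log ((m : ℝ) + 1) := Real.log_nonneg (by linarith [(Nat.cast_nonneg m : (0 : ℝ) ≤ m)])
    calc (N : ℝ) ≤ ((m : ℝ) + 1) ^ l := hN
      _ = exp (l * Real.log ((m : ℝ) + 1)) := by
          rw [← Real.rpow_natCast, Real.rpow_def_of_pos hm0, mul_comm]
      _ ≤ exp (E * (E * Real.log 2 / 4 + Real.log 8)) :=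
          exp_le_exp.2 (mul_le_mul hlE hm1 hl0 hEpos.le)
  -- `(E²)^r = exp(2 r log E) ≥ exp(2 (E²/3 - 1) log E)`
  have hEr : exp (2 * (E ^ 2 / 3 - 1) * Real.log E) ≤ (E ^ 2) ^ r := by
    rw [← Real.rpow_natCast (E ^ 2) r, Real.rpow_def_of_pos hE2, Real.log_pow]
    push_cast
    refine exp_le_exp.2 ?_
    have h0 : 0 ≤ 2 * Real.log E := by linarith
    have := mul_le_mul_of_nonneg_left hr h0
    linarith
  have ht0 : (0 : ℝ) ≤ t := Nat.cast_nonneg t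
  have h6 : exp (2 * (E ^ 2 / 3 - 1) * Real.log E) ≤
      t * exp (E * (E * Real.log 2 / 4 + Real.log 8)) :=
    hEr.trans (h5.trans (mul_le_mul_of_nonneg_left hN' ht0))
  have h7 : exp (2 * (E ^ 2 / 3 - 1) * Real.log E - E * (E * Real.log 2 / 4 + Real.log 8)) ≤ t := by
    rw [exp_sub, div_le_iff₀ (exp_pos _)]
    exact h6
  refine le_trans (exp_le_exp.2 ?_) h7
  -- `E log 2 / 4 ≤ 2 (E²/3 - 1) log E - E (E log 2 / 4 + log 8)`
  have hEE : 16 * E ≤ E ^ 2 := by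
    have := mul_le_mul_of_nonneg_right hE hEpos.le
    nlinarith [this]
  have hE3 : 0 ≤ E ^ 2 / 3 - 1 := by linarith
  have hA : 4 * (E ^ 2 / 3 - 1) ≤ 2 * (E ^ 2 / 3 - 1) * Real.log E := by
    have := mul_le_mul_of_nonneg_left (show (4 : ℝ) ≤ 2 * Real.log E by linarith) hE3
    linarith
  have hC : E * Real.log 2 / 4 ≤ E / 4 := by
    have := mul_le_mul_of_nonneg_left hlog2 (show (0 : ℝ) ≤ E / 4 by positivity)
    linarith
  have hB : E * (E * Real.log 2 / 4 + Real.log 8) ≤ E * (E / 4 + 3) := by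
    refine mul_le_mul_of_nonneg_left ?_ hEpos.le
    linarith
  linarith

/-! ### Case 1 of the final count (few minimal sets), general parameters -/

/-- **Case 1 of the final count, general parameters** (Alon–Boppana 1987, proof of
Lemma 3.14 / §3.4; Jukna 2012, proof of Thm. 9.26, Case 1, crude constants): with
`l < s ≤ m` and `9 ρ² s ≤ m`, the inequality
`C(m,s) ≤ t ρ^{2l} C(m-l-1, s-l-1) + Σ_{2≤k≤l} ρᵏ C(m-k, s-k)` forces `9^l ≤ 2t`: the error sum
is at most `C(m,s) Σ_{k≥2} (ρ s/m)^k ≤ C(m,s)/6` (as `ρ s/m ≤ 1/3`), and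
`C(m-l-1, s-l-1) ≤ C(m,s) (s/m)^{l+1}`, `ρ² s/m ≤ 1/9`.
[cite: AlonBoppana1987, Lemma 3.14] [cite: Jukna2012, Thm. 9.26 (PDF p. 284)] -/
theorem caseB_general {m s l ρ t : ℕ} (hm : 0 < m) (hls : l < s) (hsm : s ≤ m)
    (hρ : ((ρ : ℝ)) ^ 2 * s * 9 ≤ m)
    (h : m.choose s ≤ t * ((ρ ^ l) ^ 2 * (m - (l + 1)).choose (s - (l + 1))) +
      ∑ k ∈ Icc 2 l, ρ ^ k * (m - k).choose (s - k)) :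
    (9 : ℝ) ^ l ≤ 2 * t := by
  have hmpos : (0 : ℝ) < m := by exact_mod_cast hm
  have hρ0 : (0 : ℝ) ≤ ρ := Nat.cast_nonneg ρ
  have hs0 : (0 : ℝ) ≤ s := Nat.cast_nonneg s
  have hsm' : (s : ℝ) ≤ m := by exact_mod_cast hsm
  -- `x = ρ s / m ≤ 1/3`
  set x : ℝ := ρ * s / m with hx_def
  have hx0 : 0 ≤ x := by positivity
  have hx2 : x ^ 2 ≤ 1 / 9 := by
    rw [hx_def, div_pow, div_le_iff₀ (by positivity)]
    have h1 : (ρ : ℝ) ^ 2 * (s : ℝ) ≤ (m : ℝ) / 9 := by linarith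
    calc ((ρ : ℝ) * (s : ℝ)) ^ 2 = ((ρ : ℝ) ^ 2 * (s : ℝ)) * (s : ℝ) := by ring
      _ ≤ ((m : ℝ) / 9) * (m : ℝ) := mul_le_mul h1 hsm' hs0 (by positivity)
      _ = 1 / 9 * (m : ℝ) ^ 2 := by ring
  have hx13 : x ≤ 1 / 3 := by
    have h1 : x ^ 2 ≤ (1 / 3) ^ 2 := by norm_num; linarith
    exact (pow_le_pow_iff_left₀ hx0 (by norm_num) two_ne_zero).1 h1
  -- the error sum is at most `C(m,s)/6`
  have hterm : ∀ k ∈ Icc 2 l,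
      (ρ : ℝ) ^ k * ((m - k).choose (s - k) : ℝ) ≤ m.choose s * x ^ k := by
    intro k hk
    rw [mem_Icc] at hk
    have hks : k ≤ s := by omega
    calc (ρ : ℝ) ^ k * ((m - k).choose (s - k) : ℝ) ≤ (ρ : ℝ) ^ k * (m.choose s * ((s : ℝ) / m) ^ k) :=
          mul_le_mul_of_nonneg_left (cast_choose_sub_le hks hsm hm) (by positivity)
      _ = m.choose s * x ^ k := by rw [hx_def, mul_div_assoc, mul_pow]; ring
  have hgeom : ∑ k ∈ Icc 2 l, x ^ k ≤ 1 / 6 := by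
    have hIcc : Icc 2 l = Ico 2 (l + 1) := rfl
    rw [hIcc]
    calc ∑ k ∈ Ico 2 (l + 1), x ^ k ≤ x ^ 2 / (1 - x) :=
          geom_sum_Ico_le_of_lt_one hx0 (by linarith)
      _ ≤ (1 / 9) / (2 / 3) := by
          refine div_le_div₀ (by norm_num) hx2 (by norm_num) (by linarith)
      _ = 1 / 6 := by norm_num
  have hsum : ∑ k ∈ Icc 2 l, (ρ : ℝ) ^ k * ((m - k).choose (s - k) : ℝ) ≤ (m.choose s : ℝ) / 6 :=
    calc ∑ k ∈ Icc 2 l, (ρ : ℝ) ^ k * ((m - k).choose (s - k) : ℝ)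
        ≤ ∑ k ∈ Icc 2 l, (m.choose s : ℝ) * x ^ k := sum_le_sum hterm
      _ = m.choose s * ∑ k ∈ Icc 2 l, x ^ k := by rw [mul_sum]
      _ ≤ m.choose s * (1 / 6) := mul_le_mul_of_nonneg_left hgeom (by positivity)
      _ = (m.choose s : ℝ) / 6 := by ring
  -- cast the hypothesis
  have hR : (m.choose s : ℝ) ≤ t * (((ρ : ℝ) ^ l) ^ 2 * ((m - (l + 1)).choose (s - (l + 1)) : ℝ)) +
      ∑ k ∈ Icc 2 l, (ρ : ℝ) ^ k * ((m - k).choose (s - k) : ℝ) := by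
    exact_mod_cast h
  have hC : (m.choose s : ℝ) / 2 ≤
      t * (((ρ : ℝ) ^ l) ^ 2 * ((m - (l + 1)).choose (s - (l + 1)) : ℝ)) := by
    linarith
  -- `C(m-l-1, s-l-1) ≤ C(m,s) (s/m)^{l+1}` and `C(m,s) > 0`
  have hch : ((m - (l + 1)).choose (s - (l + 1)) : ℝ) ≤ m.choose s * ((s : ℝ) / m) ^ (l + 1) :=
    cast_choose_sub_le (by omega) hsm hm
  have hCpos : (0 : ℝ) < m.choose s := by exact_mod_cast Nat.choose_pos hsm
  have ht0 : (0 : ℝ) ≤ t := Nat.cast_nonneg t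
  have h1 : 1 / 2 * (m.choose s : ℝ) ≤
      (t * (((ρ : ℝ) ^ 2 * ((s : ℝ) / m)) ^ l * ((s : ℝ) / m))) * m.choose s := by
    calc 1 / 2 * (m.choose s : ℝ) = (m.choose s : ℝ) / 2 := by ring
      _ ≤ t * (((ρ : ℝ) ^ l) ^ 2 * ((m - (l + 1)).choose (s - (l + 1)) : ℝ)) := hC
      _ ≤ t * (((ρ : ℝ) ^ l) ^ 2 * (m.choose s * ((s : ℝ) / m) ^ (l + 1))) :=
          mul_le_mul_of_nonneg_left (mul_le_mul_of_nonneg_left hch (by positivity)) ht0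
      _ = _ := by ring
  have h2 : 1 / 2 ≤ t * (((ρ : ℝ) ^ 2 * ((s : ℝ) / m)) ^ l * ((s : ℝ) / m)) :=
    le_of_mul_le_mul_right h1 hCpos
  have hbase : (ρ : ℝ) ^ 2 * ((s : ℝ) / m) ≤ 1 / 9 := by
    rw [← mul_div_assoc, div_le_iff₀ hmpos]
    linarith
  have hsm1 : (s : ℝ) / m ≤ 1 := by rwa [div_le_one hmpos]
  have hb0 : 0 ≤ (ρ : ℝ) ^ 2 * ((s : ℝ) / m) := by positivity
  have h3 : ((ρ : ℝ) ^ 2 * ((s : ℝ) / m)) ^ l * ((s : ℝ) / m) ≤ (1 / 9) ^ l := by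
    calc ((ρ : ℝ) ^ 2 * ((s : ℝ) / m)) ^ l * ((s : ℝ) / m) ≤ (1 / 9) ^ l * 1 :=
          mul_le_mul (pow_le_pow_left₀ hb0 hbase l) hsm1 (by positivity) (by positivity)
      _ = (1 / 9) ^ l := mul_one _
  have h4 : (1 / 2 : ℝ) ≤ t * (1 / 9 : ℝ) ^ l := h2.trans (mul_le_mul_of_nonneg_left h3 ht0)
  have h9 : (0 : ℝ) < 9 ^ l := by positivity
  have h19 : (1 / 9 : ℝ) ^ l = (9 ^ l)⁻¹ := by rw [one_div, inv_pow]
  rw [h19] at h4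
  have := mul_le_mul_of_nonneg_right h4 h9.le
  rw [mul_assoc, inv_mul_cancel₀ h9.ne', mul_one] at this
  linarith

/-! ### The main regime -/

/-- **The approximation method for `(a, b)`-clique functions, main regime** (Jukna 2012,
Thm. 9.26; Alon–Boppana 1987, §3.4, crude constants). Let `E ≥ 16` with `E⁴ ≤ a`,
`E⁴ b ≤ n`, `a < b` and `log(n+1) ≤ (E log 2)/4 + log 8`. If `f` accepts every `b`-clique and
rejects the complete `a`-partite graph of every `a`-colouring, then every circuit over
`{∧₂, ∨₂}` computing `f` has at least `2^{E/4}` gates: `razborov_dichotomy_wide` with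
`l = ⌊E⌋`, `r = ⌊E²/3⌋`, then `caseA_general` / `caseB_general` (`9^l ≤ 2t`, and
`2 · 2^{E/4} ≤ 9^{E-1}`). [cite: Jukna2012, Thm. 9.26 (PDF pp. 283–284)] [cite: AlonBoppana1987, Lemma 3.14] -/
theorem cliqueLike_lowerBound_main {n a b : ℕ} {E : ℝ} (hE : 16 ≤ E) (hEa : E ^ 4 ≤ a)
    (hEb : E ^ 4 * b ≤ n) (hab : a < b)
    (hlog : Real.log ((n : ℝ) + 1) ≤ E * Real.log 2 / 4 + Real.log 8)
    {f : (KEdge n → Bool) → Bool}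
    (hpos : ∀ Z : Finset (Fin n), #Z = b → f (cliqueVec Z) = true)
    (hneg : ∀ O : Fin n → Fin a, f (colorVec O) = false)
    (C : Circuit (KEdge n)) (hCB : C.IsOver monotoneBasis) (hCf : C.Computes f) :
    exp (E * Real.log 2 / 4) ≤ C.size := by
  have hE1 : (1 : ℝ) ≤ E := by linarith
  have hEpos : (0 : ℝ) < E := by linarith
  have hb0 : 0 < b := by omega
  have hb0' : (0 : ℝ) < b := by exact_mod_cast hb0
  have hE41 : (1 : ℝ) ≤ E ^ 4 := one_le_pow₀ hE1
  have hbn' : (b : ℝ) ≤ n := by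
    have : (1 : ℝ) * b ≤ E ^ 4 * b := mul_le_mul_of_nonneg_right hE41 hb0'.le
    linarith
  have hbn : b ≤ n := by exact_mod_cast hbn'
  have hn0 : 0 < n := by omega
  -- `l = ⌊E⌋`
  set l : ℕ := ⌊E⌋₊ with hl_def
  have hlE : (l : ℝ) ≤ E := Nat.floor_le hEpos.le
  have hEl : E < l + 1 := Nat.lt_floor_add_one E
  have hl2 : 2 ≤ l := by
    have : (15 : ℝ) < l := by linarith
    have : 15 < l := by exact_mod_cast this
    omega
  have hl1 : 1 ≤ l := by omega
  have hlb : l < b := by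
    have h1 : (l : ℝ) ≤ a := hlE.trans ((le_self_pow₀ hE1 (by norm_num)).trans hEa)
    have h2 : l ≤ a := by exact_mod_cast h1
    omega
  -- `r = ⌊E²/3⌋`
  set r : ℕ := ⌊E ^ 2 / 3⌋₊ with hr_def
  have hrE : (r : ℝ) ≤ E ^ 2 / 3 := Nat.floor_le (by positivity)
  have hEr : E ^ 2 / 3 < r + 1 := Nat.lt_floor_add_one _
  have hr' : E ^ 2 / 3 - 1 ≤ r := by linarith
  have hr2 : 2 ≤ r := by
    have h256 : (256 : ℝ) ≤ E ^ 2 := by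
      have := pow_le_pow_left₀ (by norm_num) hE 2
      norm_num at this
      exact this
    have : (2 : ℝ) < r := by linarith
    have : 2 < r := by exact_mod_cast this
    omega
  -- `ρ = r - 1`: `9 ρ² b ≤ n`
  have hρ : (((r - 1 : ℕ) : ℝ)) ^ 2 * b * 9 ≤ n := by
    have h1 : ((r - 1 : ℕ) : ℝ) ≤ E ^ 2 / 3 := by
      have : ((r - 1 : ℕ) : ℝ) = r - 1 := by
        push_cast [Nat.cast_sub (by omega : 1 ≤ r)]; ring
      rw [this]; linarith
    have h0 : (0 : ℝ) ≤ ((r - 1 : ℕ) : ℝ) := Nat.cast_nonneg _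
    have h2 : (((r - 1 : ℕ) : ℝ)) ^ 2 ≤ (E ^ 2 / 3) ^ 2 := pow_le_pow_left₀ h0 h1 2
    calc (((r - 1 : ℕ) : ℝ)) ^ 2 * b * 9 ≤ (E ^ 2 / 3) ^ 2 * b * 9 := by
          have := mul_le_mul_of_nonneg_right h2 hb0'.le
          linarith
      _ = E ^ 4 * b := by ring
      _ ≤ n := hEb
  rcases razborov_dichotomy_wide (r := r) (l := l) (s := b) (g := a) hr2 hl2 hlb C hCB hCf
      hpos hneg with hA | hB
  · -- Case 2: the approximator accepts everything
    refine caseA_general hE hl1 hlE hEa hr' ?_ hlog hA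
    have h := Razborov.card_smallSets_le (α := Fin n) l
    rw [Fintype.card_fin] at h
    exact_mod_cast h
  · -- Case 1: few minimal sets
    have h9 := caseB_general (ρ := r - 1) hn0 hlb hbn hρ hB
    have hlog2 : Real.log 2 ≤ 1 := by
      rw [Real.log_le_iff_le_exp two_pos]
      linarith [add_one_le_exp (1 : ℝ)]
    have hlog9 : 2 ≤ Real.log 9 := by
      rw [Real.le_log_iff_exp_le (by norm_num)]
      have h1 : exp 2 = exp 1 * exp 1 := by rw [← exp_add]; norm_num
      rw [h1]
      nlinarith [Real.exp_one_lt_d9, exp_pos (1 : ℝ)]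
    have h9l : (9 : ℝ) ^ l = exp (l * Real.log 9) := by
      rw [← Real.rpow_natCast, Real.rpow_def_of_pos (by norm_num), mul_comm]
    have hkey : E * Real.log 2 / 4 + Real.log 2 ≤ l * Real.log 9 := by
      have h1 : (E - 1) * 2 ≤ l * Real.log 9 :=
        mul_le_mul (by linarith) hlog9 (by norm_num) (Nat.cast_nonneg l)
      have h2 := mul_le_mul_of_nonneg_left hlog2 (show (0 : ℝ) ≤ E / 4 by positivity)
      linarith
    have ht : exp (E * Real.log 2 / 4 + Real.log 2) ≤ 2 * (C.size : ℝ) := by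
      refine le_trans (exp_le_exp.2 hkey) ?_
      rw [← h9l]
      exact h9
    rw [exp_add, Real.exp_log two_pos] at ht
    linarith [exp_pos (E * Real.log 2 / 4)]

/-! ### Discharge of `Jukna2012_cliqueLike_lowerBound` -/

/-- **Discharge of `Jukna2012_cliqueLike_lowerBound`** (Jukna 2012, Thm. 9.26, for monotone
Boolean circuits; Tardos 1988, p. 141, Corollary (Razborov; Alon–Boppana)): with `c = 1/4`,
for all `n ≥ 64`, every `(a, b)`-clique function with `32 ≤ a < b ≤ n/32` needs monotone
`{∧₂, ∨₂}`-circuits of size `≥ 2^{c · min(a, n/b)^{1/4}}`. Proof: with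
`E = min(a, n/b)^{1/4}`, either `2^{E/4} ≤ n/4`, and then the trivial bound
`n ≤ b + 2 · size` (`le_add_two_mul_size`: every `b`-set spans an edge of the light cone)
suffices since `b ≤ n/32`; or `E > 16` and `log(n+1) ≤ (E log 2)/4 + log 8`, and
`cliqueLike_lowerBound_main` (Razborov's approximation method in the Alon–Boppana lattice,
wide regime) applies. The book's own proof runs the length-measure criterion (Thm. 9.25)
instead; the exponent `min(a, n/b)^{1/4}` is the same.
[cite: Jukna2012, Thm. 9.26 (PDF pp. 283–284)] [cite: Tardos1988, p. 141 (Corollary)] [cite: AlonBoppana1987, Lemma 3.14] -/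
theorem Jukna2012_cliqueLike_lowerBound_holds : Jukna2012_cliqueLike_lowerBound := by
  refine ⟨1 / 4, by norm_num, ?_⟩
  filter_upwards [eventually_ge_atTop 64] with n hn a b ha hab hbn f hf C hCB hCf
  have hb0 : 0 < b := by omega
  have hb0' : (0 : ℝ) < b := by exact_mod_cast hb0
  have hn' : (64 : ℝ) ≤ n := by exact_mod_cast hn
  set q : ℝ := min (a : ℝ) ((n : ℝ) / b) with hq_def
  have hq0 : 0 ≤ q := le_min (Nat.cast_nonneg a) (by positivity)
  set E : ℝ := q ^ (1 / 4 : ℝ) with hE_def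
  have hE4 : E ^ 4 = q := by
    rw [hE_def, show (1 / 4 : ℝ) = ((4 : ℕ) : ℝ)⁻¹ by norm_num]
    exact Real.rpow_inv_natCast_pow hq0 (by norm_num)
  have hEa : E ^ 4 ≤ a := hE4 ▸ min_le_left _ _
  have hEb : E ^ 4 * b ≤ n := by
    rw [hE4]
    have h1 : q ≤ (n : ℝ) / b := min_le_right _ _
    exact (le_div_iff₀ hb0').1 h1
  -- the test behaviours of a clique-like function
  have hpos : ∀ Z : Finset (Fin n), #Z = b → f (cliqueVec Z) = true := fun Z hZ =>
    hf.accepts Z (subset_univ _) hZ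
  have hneg : ∀ O : Fin n → Fin a, f (colorVec O) = false := fun O => by
    have h := hf.rejects O
    rwa [colorTest_univ] at h
  have h0 : f (fun _ => false) = false := by
    have h := hneg fun _ => ⟨0, by omega⟩
    rwa [colorVec_const] at h
  -- the target in exponential form
  have htarget : (2 : ℝ) ^ (1 / 4 * E) = exp (E * Real.log 2 / 4) := by
    rw [Real.rpow_def_of_pos two_pos]
    congr 1
    ring
  rw [htarget]
  by_cases hreg : exp (E * Real.log 2 / 4) ≤ (n : ℝ) / 4
  · -- trivial regime: `n ≤ b + 2 · size` and `32 b ≤ n`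
    have hsize := le_add_two_mul_size hpos h0 C hCB hCf
    have h1 : (n : ℝ) ≤ b + 2 * (C.size : ℝ) := by exact_mod_cast hsize
    have h2 : 32 * (b : ℝ) ≤ n := by exact_mod_cast hbn
    refine hreg.trans ?_
    linarith
  · -- main regime
    push Not at hreg
    have hlog2pos : 0 < Real.log 2 := Real.log_pos one_lt_two
    have hE16 : 16 ≤ E := by
      by_contra hlt
      push Not at hlt
      have h1 : exp (E * Real.log 2 / 4) ≤ exp (4 * Real.log 2) := by
        refine exp_le_exp.2 ?_
        have := mul_le_mul_of_nonneg_right hlt.le hlog2pos.le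
        linarith
      have h16 : exp (4 * Real.log 2) = 16 := by
        rw [show (4 : ℝ) * Real.log 2 = Real.log 16 by
          rw [show (16 : ℝ) = 2 ^ 4 by norm_num, Real.log_pow]; push_cast; ring]
        exact Real.exp_log (by norm_num)
      rw [h16] at h1
      linarith
    have hlog : Real.log ((n : ℝ) + 1) ≤ E * Real.log 2 / 4 + Real.log 8 := by
      have h1 : (n : ℝ) + 1 ≤ 8 * exp (E * Real.log 2 / 4) := by linarith
      have h2 : (0 : ℝ) < (n : ℝ) + 1 := by positivity
      calc Real.log ((n : ℝ) + 1) ≤ Real.log (8 * exp (E * Real.log 2 / 4)) :=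
            Real.log_le_log h2 h1
        _ = Real.log 8 + E * Real.log 2 / 4 := by
            rw [Real.log_mul (by norm_num) (exp_pos _).ne', Real.log_exp]
        _ = E * Real.log 2 / 4 + Real.log 8 := by ring
    exact cliqueLike_lowerBound_main hE16 hEa hEb hab hlog hpos hneg C hCB hCf

end General

end Literature.Barriers.PneNP

end
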